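import Summits.QuantumFields.BalabanUV.Beta.EriceFlowEnclosureB12AsPrintedHistoryContagionShiftFlowZeroTangentDeriv

/-!
# Beta / EriceFlowEnclosureB12AsPrintedHistoryContagionShiftFlowZeroTangentLambda — ASYMPTOTIC FREEDOM IS CONTAGIOUS, part 70: THE Λ-COORDINATE IS DIFFERENTIABLE AT EVERY
# COUPLING, WITH DERIVATIVE THE ULTRAVIOLET LIMIT OF THE TANGENT FLOW.  FOR THE FLOW (part 14's package at e′) under part 68's def-free C¹ shape (`hG`, `hGB`): (§117) the
# tangent flow W at a pin e of ]0, e′] HAS AN ULTRAVIOLET LIMIT **`W_∞ = lim_k W_k`** with the AF rate `|W_∞ − W_n| ≤ (C_m∕(1−θ))·(8∕β*)·(1∕(4e′²) + (β*∕4)n)^{−1∕2}` (parts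
# 66–67: constant source, telescoping weight tails — UNIFORM IN THE PIN), `|W_∞ − 1| ≤ C_m(8e³ + 16e∕β*)∕(1−θ)`, `W_∞ ∈ [3∕4, 5∕4]`; (§118) for EVERY dynamical Abel function Λ
# of the flow near the zero pin (part 44's interface: `1∕h_n² − a_n → Λ(e)` along every box solution from every pin, ANY comparison sequence a — part 35's relative Λ,
# part 40's two-loop Λ₂, …) and every INTERIOR pin e: **`HasDerivAt Λ (W_∞·(−2∕e³)) e`** — the chart quotient of Λ between ẽ and e is the k → ∞ limit of part 69's
# quotients D_k, which are ε₀-close to W_k FOR ALL k AT ONCE near e (part 69 §115), so it is ε₀-close to W_∞: NO uniform-limit-of-derivatives theorem is needed, asymptotic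
# freedom supplied the uniformity; (§119) hence **Λ is differentiable on ]0, e′[**, `deriv Λ e = −2W_∞∕e³ < 0`, and **`|(−e³∕2)·Λ′(e) − 1| ≤ C_m(8e³ + 16e∕β*)∕(1−θ)` at EVERY
# interior coupling** — part 57's (#73d) almost-everywhere one-loop law `|(−x³∕2)Λ′(x) − 1| ≤ κx` LOSES ITS QUALIFIER under the C¹ shape (and holds with both constants).
# Part 71 adds continuity of `e ↦ W_∞(e)` under the continuity letter of the gradient: Λ ∈ C¹, and #73g's smooth theory is inhabited by the flow
# (β-flow team, prover 1, unit `b2b-balaban-beta-bflow-p1`, gen 42; ROW AP-I·Uc × NODE U2)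

HONEST FRAMING (page 1 of everything the β sub-cell writes): discharging `BetaPertH` makes Bałaban's UV stability UNCONDITIONAL — a
real constructive-QFT result; it is NOT the continuum limit and NOT the Clay problem.  HONEST DEPENDENCY (cell reorg 2026-08-19,
verbatim): «continuum YM on T⁴ ⇐ BetaPertH ∧ nine spine estimates (0/9 proved); BetaPertH ⇐ (D1) ∧ (D4) ∧ CAP+tail; G-an2-4 gates
asym, D1 and NE2/3/4.»  THIS MODULE DISCHARGES NOTHING: [folklore] real analysis (parts 66–69 by name; limits of sequences and the slope characterisation of the derivative,
from Mathlib) over node U2's HYPOTHESIS SHAPES `T4BetaStationary.{SeqBox, MemoryProfile}`, `T4BetaFlowWellPosed.{MemFlow, solution}` consumed BY NAME (NOT PRINTED for [I] =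
T. Bałaban, Commun. Math. Phys. **109** (1987) [Balaban1987RG1]: p. 298 says only that β_j depends on the preceding couplings; (0.20) p. 256; Theorem 2 (0.31) p. 259 STATED
WITHOUT PROOF; Erice 1985 (3.73)∕(3.76) p. 250 name Λ for the CONTINUUM coupling — a reading, not asserted).  The C¹ shape is OUR explicit binder.  Nothing of Bałaban's β
is asserted.

WHAT THIS FILE PROVES (0 sorry, 0 def): §117 **`tangentLimit_exists`** (the limit is unique by Mathlib's `tendsto_nhds_unique`); §118 `dynAbel_sub_eq_lim`, `lim_quotient_sub_tangentLimit_abs_le`,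
**`hasDerivAt_dynAbel`**; §119 **`differentiableAt_dynAbel`**, `deriv_dynAbel_eq`, **`abs_deriv_dynAbel_oneLoop`**, `deriv_dynAbel_neg`, **`differentiableOn_dynAbel`**.
NOT CLAIMED: continuity of the derivative (part 71); anything about Bałaban's β; `BetaPertH`; the continuum limit of the measures; Clay.
-/

namespace Summit.QuantumFields.BalabanUV.Beta.EriceFlowEnclosureB12AsPrintedHistoryContagionShiftFlowZeroTangentLambda

open Finset Filter Topology Set
open Literature.MathematicalPhysics.QuantumFieldTheory.Balaban1983to89
open Literature.MathematicalPhysics.QuantumFieldTheory.Balaban1983to89.T4CouplingMatching (prof sprof sprof_pos sprof_sq prof_pos sprof_zero)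
open Literature.MathematicalPhysics.QuantumFieldTheory.Balaban1983to89.T4BetaStationary (SeqBox MemoryProfile)
open Literature.MathematicalPhysics.QuantumFieldTheory.Balaban1983to89.T4BetaFlowWellPosed (MemFlow drive solution seqBox_shift invSq_eq_of_memFlow)
open Summit.QuantumFields.BalabanUV.Beta.EriceFlowEnclosureB12AsPrintedHistoryContagionShiftFlowZeroTangent (fixedPoint_exists fixedPoint_unique)
open Summit.QuantumFields.BalabanUV.Beta.EriceFlowEnclosureB12AsPrintedHistoryContagionShiftFlowZeroTangentLimit (profWeight_nonneg profWeight_anti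
  sum_profWeight_le sum_Ico_profWeight_le inv_sprof_tendsto_zero fixedPoint_limit_exists)
open Summit.QuantumFields.BalabanUV.Beta.EriceFlowEnclosureB12AsPrintedHistoryContagionShiftFlowZeroTangentFlow (solution_facts tangent_data smallness_of_hs5
  tangent_exists tangent_sub_one_abs_le quotient_mem_Icc)
open Summit.QuantumFields.BalabanUV.Beta.EriceFlowEnclosureB12AsPrintedHistoryContagionShiftFlowZeroTangentDeriv (invSq_sub_ne_zero quotient_tendsto_tangent_uniform)

noncomputable section

/-! ## §117 The ultraviolet limit of the tangent flow -/

/-- **THE TANGENT FLOW HAS AN ULTRAVIOLET LIMIT**, with the AF rate UNIFORM IN THE PIN: for the tangent flow W at `e ∈ ]0, e′]` there is `W_∞ = lim_k W_k` with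
`|W_∞ − W_n| ≤ (C_m∕(1−θ))·(8∕β*)·(1∕(4e′²) + (β*∕4)n)^{−1∕2}` (parts 66–67: constant source 1, telescoping weight tails), **`|W_∞ − 1| ≤ C_m(8e³ + 16e∕β*)∕(1−θ)`** and
`3∕4 ≤ W_∞ ≤ 5∕4`. [cite: Balaban1987RG1, Thm 2 (0.31) p.259 with (0.20) p.256 and p.298] -/
theorem tangentLimit_exists {B : (ℕ → ℝ) → ℝ} {G : (ℕ → ℝ) → ℕ → ℝ} {Cm θ γ bs ta gs e' : ℝ} {t W : ℕ → ℝ}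
    (hB : MemoryProfile Cm θ γ B) (hCm : 0 ≤ Cm) (hθ0 : 0 ≤ θ) (hθ1 : θ < 1) (hbs : 0 < bs) (hta : 0 < ta)
    (hts : SeqBox γ t) (htf : MemFlow B gs t) (hprof : ∀ m : ℕ, 1 / ta ^ 2 + bs * (m : ℝ) ≤ 1 / (t m) ^ 2)
    (hG : ∀ u : ℕ → ℝ, SeqBox γ u → ∀ j, |G u j| ≤ Cm * θ ^ j)
    (h2e' : 2 * e' ≤ γ) (hs1 : 4 * Cm * e' ≤ bs * (1 - θ))
    (hs2 : e' ^ 2 * (1 / gs ^ 2 + Cm * γ / (1 - θ) ^ 2 + (2 * Cm / ((1 - θ) * bs)) ^ 2) ≤ 3 / 4)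
    (hs4 : 64 * Cm * e' ^ 3 ≤ (1 - θ) ^ 2) (hs5 : Cm * (8 * e' ^ 3 + 16 * e' / bs) ≤ (1 - θ) / 4) {e : ℝ} (he : e ∈ Ioc (0 : ℝ) e')
    (hW : ∀ k, W k = 1 - ∑ p ∈ range k, ∑' j, G (fun i => solution B e (p + 1 + i)) j * ((solution B e (p + 1 + j)) ^ 3 / 2) * W (p + 1 + j))
    (hWM : ∀ k, |W k| ≤ 2) :
    ∃ Winf : ℝ, Tendsto W atTop (𝓝 Winf) ∧
      (∀ n : ℕ, |Winf - W n| ≤ Cm / (1 - θ) * (8 / bs * (1 / sprof (2 * e') (bs / 4) n))) ∧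
      |Winf - 1| ≤ Cm * (8 * e ^ 3 + 16 * e / bs) / (1 - θ) ∧ 3 / 4 ≤ Winf ∧ Winf ≤ 5 / 4 := by
  have he' : 0 < e' := he.1.trans_le he.2
  have h1θ : 0 < 1 - θ := by linarith
  obtain ⟨hsb, -, -, -, -, hcube⟩ := solution_facts hB hCm hθ0 hθ1 hbs hta hts htf hprof h2e' hs1 hs2 hs4 hs5 he
  obtain ⟨hc, hv⟩ := tangent_data (B := B) (e' := e') hG hsb hcube
  obtain ⟨Winf, hT, hrate⟩ := fixedPoint_limit_exists (s := fun _ => (1 : ℝ)) (sinf := 1)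
    (τ := fun n => 8 / bs * (1 / sprof (2 * e') (bs / 4) n)) hCm hθ0 hθ1 (fun hab => profWeight_anti hbs he' hab) hc hv hW hWM
    (fun n k _ => sum_Ico_profWeight_le hbs he' n k)
    (by simpa using (inv_sprof_tendsto_zero (γ := 2 * e') (by positivity : 0 < bs / 4)).const_mul (8 / bs)) tendsto_const_nhds
  have hb := fun k => tangent_sub_one_abs_le hB hCm hθ0 hθ1 hbs hta hts htf hprof hG h2e' hs1 hs2 hs4 hs5 he hW hWM k
  refine ⟨Winf, hT, fun n => ?_, ?_, ?_, ?_⟩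
  · have h := hrate n
    rw [sub_self, sub_zero] at h
    calc |Winf - W n| ≤ Cm * (2 / 2) / (1 - θ) * (8 / bs * (1 / sprof (2 * e') (bs / 4) n)) := h
      _ = Cm / (1 - θ) * (8 / bs * (1 / sprof (2 * e') (bs / 4) n)) := by ring
  · exact le_of_tendsto ((continuous_abs.tendsto _).comp (hT.sub_const 1)) (Eventually.of_forall fun k => (hb k).1)
  · exact ge_of_tendsto hT (Eventually.of_forall fun k => (hb k).2.1)
  · exact le_of_tendsto hT (Eventually.of_forall fun k => (hb k).2.2)

/-! ## §118 The derivative of a dynamical Abel function at an interior coupling -/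

/-- THE INCREMENT OF Λ IS THE ULTRAVIOLET LIMIT OF THE CHART SEPARATION of the two solutions: `1∕h̃_n² − 1∕h_n² → Λ ẽ − Λ e` (any comparison sequence cancels).
[cite: Balaban1987RG1, Thm 2 (0.31) p.259 with (0.20) p.256] -/
theorem dynAbel_sub_eq_lim {B : (ℕ → ℝ) → ℝ} {Cm θ γ bs ta gs e' : ℝ} {t : ℕ → ℝ} {a : ℕ → ℝ} {Λ : ℝ → ℝ}
    (hB : MemoryProfile Cm θ γ B) (hCm : 0 ≤ Cm) (hθ0 : 0 ≤ θ) (hθ1 : θ < 1) (hbs : 0 < bs) (hta : 0 < ta)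
    (hts : SeqBox γ t) (htf : MemFlow B gs t) (hprof : ∀ m : ℕ, 1 / ta ^ 2 + bs * (m : ℝ) ≤ 1 / (t m) ^ 2)
    (hΛ : ∀ e ∈ Ioc (0 : ℝ) e', ∀ h : ℕ → ℝ, SeqBox γ h → MemFlow B e h → Tendsto (fun n => 1 / h n ^ 2 - a n) atTop (𝓝 (Λ e)))
    (h2e' : 2 * e' ≤ γ) (hs1 : 4 * Cm * e' ≤ bs * (1 - θ))
    (hs2 : e' ^ 2 * (1 / gs ^ 2 + Cm * γ / (1 - θ) ^ 2 + (2 * Cm / ((1 - θ) * bs)) ^ 2) ≤ 3 / 4)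
    (hs4 : 64 * Cm * e' ^ 3 ≤ (1 - θ) ^ 2) (hs5 : Cm * (8 * e' ^ 3 + 16 * e' / bs) ≤ (1 - θ) / 4)
    {e ee : ℝ} (he : e ∈ Ioc (0 : ℝ) e') (hee : ee ∈ Ioc (0 : ℝ) e') :
    Tendsto (fun n => 1 / (solution B ee n) ^ 2 - 1 / (solution B e n) ^ 2) atTop (𝓝 (Λ ee - Λ e)) := by
  obtain ⟨hsb, hsf, -⟩ := solution_facts hB hCm hθ0 hθ1 hbs hta hts htf hprof h2e' hs1 hs2 hs4 hs5 he
  obtain ⟨hsbb, hsff, -⟩ := solution_facts hB hCm hθ0 hθ1 hbs hta hts htf hprof h2e' hs1 hs2 hs4 hs5 hee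
  have h := (hΛ ee hee _ hsbb hsff).sub (hΛ e he _ hsb hsf)
  refine h.congr fun n => ?_
  ring

/-- THE CHART QUOTIENT OF Λ IS ε₀-CLOSE TO THE ULTRAVIOLET LIMIT OF THE TANGENT FLOW whenever all the scale-k quotients are ε₀-close to the tangent flow (limits k → ∞ on
both sides). [folklore] -/
theorem lim_quotient_sub_tangentLimit_abs_le {D W : ℕ → ℝ} {Dinf Winf ε₀ : ℝ} (hD : Tendsto D atTop (𝓝 Dinf)) (hW : Tendsto W atTop (𝓝 Winf))
    (hclose : ∀ k, |D k - W k| ≤ ε₀) : |Dinf - Winf| ≤ ε₀ :=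
  le_of_tendsto ((continuous_abs.tendsto _).comp (hD.sub hW)) (Eventually.of_forall hclose)

/-- **THE Λ-COORDINATE IS DIFFERENTIABLE AT EVERY INTERIOR COUPLING, WITH DERIVATIVE `−2W_∞∕e³`.**  Part 14's package at e′; part 68's C¹ shape (`hG`, `hGB`); Λ ANY
dynamical Abel function of the flow near the zero pin (part 44's interface); `e ∈ ]0, e′[`; W the tangent flow at e with ultraviolet limit W_∞.  THEN
**`HasDerivAt Λ (W_∞·(−2∕e³)) e`**: the slope of Λ between e and ẽ is `D_∞(ẽ)·(1∕ẽ² − 1∕e²)∕(ẽ − e)` with `D_∞(ẽ) = lim_k D_k`, `|D_∞(ẽ) − W_∞| ≤ ε₀` for ẽ near e because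
`|D_k − W_k| ≤ ε₀` for ALL k there (part 69), and `(1∕ẽ² − 1∕e²)∕(ẽ − e) → −2∕e³`. [cite: Balaban1987RG1, Thm 2 (0.31) p.259 with (0.20) p.256 and p.298] -/
theorem hasDerivAt_dynAbel {B : (ℕ → ℝ) → ℝ} {G : (ℕ → ℝ) → ℕ → ℝ} {Cm θ γ bs ta gs e' : ℝ} {t W : ℕ → ℝ} {a : ℕ → ℝ} {Λ : ℝ → ℝ}
    (hB : MemoryProfile Cm θ γ B) (hCm : 0 ≤ Cm) (hθ0 : 0 ≤ θ) (hθ1 : θ < 1) (hbs : 0 < bs) (hta : 0 < ta)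
    (hts : SeqBox γ t) (htf : MemFlow B gs t) (hprof : ∀ m : ℕ, 1 / ta ^ 2 + bs * (m : ℝ) ≤ 1 / (t m) ^ 2)
    (hG : ∀ u : ℕ → ℝ, SeqBox γ u → ∀ j, |G u j| ≤ Cm * θ ^ j)
    (hGB : ∀ ε > 0, ∃ ρ > 0, ∀ u u' : ℕ → ℝ, SeqBox γ u → SeqBox γ u' → (∀ j, |u' j - u j| ≤ ρ) →
      |B u' - B u - ∑' j, G u j * (u' j - u j)| ≤ ε * ∑' j, θ ^ j * |u' j - u j|)
    (hΛ : ∀ e ∈ Ioc (0 : ℝ) e', ∀ h : ℕ → ℝ, SeqBox γ h → MemFlow B e h → Tendsto (fun n => 1 / h n ^ 2 - a n) atTop (𝓝 (Λ e)))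
    (h2e' : 2 * e' ≤ γ) (hs1 : 4 * Cm * e' ≤ bs * (1 - θ))
    (hs2 : e' ^ 2 * (1 / gs ^ 2 + Cm * γ / (1 - θ) ^ 2 + (2 * Cm / ((1 - θ) * bs)) ^ 2) ≤ 3 / 4)
    (hs4 : 64 * Cm * e' ^ 3 ≤ (1 - θ) ^ 2) (hs5 : Cm * (8 * e' ^ 3 + 16 * e' / bs) ≤ (1 - θ) / 4) {e : ℝ} (he : e ∈ Ioo (0 : ℝ) e')
    (hW : ∀ k, W k = 1 - ∑ p ∈ range k, ∑' j, G (fun i => solution B e (p + 1 + i)) j * ((solution B e (p + 1 + j)) ^ 3 / 2) * W (p + 1 + j))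
    (hWM : ∀ k, |W k| ≤ 2) {Winf : ℝ} (hWinf : Tendsto W atTop (𝓝 Winf)) :
    HasDerivAt Λ (Winf * (-2 / e ^ 3)) e := by
  have hec : e ∈ Ioc (0 : ℝ) e' := ⟨he.1, he.2.le⟩
  -- the chart quotient of Λ tends to W_∞
  have hD : Tendsto (fun ee => (Λ ee - Λ e) / (1 / ee ^ 2 - 1 / e ^ 2)) (𝓝[≠] e) (𝓝 Winf) := by
    refine Metric.tendsto_nhds.2 fun ε₀ hε₀ => ?_
    have hU := quotient_tendsto_tangent_uniform hB hCm hθ0 hθ1 hbs hta hts htf hprof hG hGB h2e' hs1 hs2 hs4 hs5 he hW hWM (half_pos hε₀)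
    have hmem : ∀ᶠ ee in 𝓝 e, ee ∈ Ioc (0 : ℝ) e' := Filter.eventually_of_mem (Ioo_mem_nhds he.1 he.2) fun x hx => ⟨hx.1, hx.2.le⟩
    filter_upwards [hU, eventually_nhdsWithin_of_eventually_nhds hmem] with ee hclose hee
    have hlim := dynAbel_sub_eq_lim hB hCm hθ0 hθ1 hbs hta hts htf hprof hΛ h2e' hs1 hs2 hs4 hs5 hec hee
    have hlimD : Tendsto (fun n => (1 / (solution B ee n) ^ 2 - 1 / (solution B e n) ^ 2) / (1 / ee ^ 2 - 1 / e ^ 2)) atTop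
        (𝓝 ((Λ ee - Λ e) / (1 / ee ^ 2 - 1 / e ^ 2))) := hlim.div_const _
    have h := lim_quotient_sub_tangentLimit_abs_le hlimD hWinf hclose
    rw [Real.dist_eq]
    linarith
  -- the chart has derivative −2/e³
  have hchart : HasDerivAt (fun x : ℝ => 1 / x ^ 2) (-2 / e ^ 3) e := by
    have h1 : HasDerivAt (fun x : ℝ => x ^ 2) (2 * e) e := by simpa using hasDerivAt_pow 2 e
    have h2 := h1.fun_inv (pow_ne_zero 2 he.1.ne')
    have e3 : -(2 * e) / (e ^ 2) ^ 2 = -2 / e ^ 3 := by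
      rw [div_eq_div_iff (by have := he.1; positivity) (by have := he.1; positivity)]; ring
    rw [← e3]
    refine h2.congr_of_eventuallyEq (Eventually.of_forall fun x => ?_)
    simp [one_div]
  have hslope := hasDerivAt_iff_tendsto_slope.1 hchart
  rw [slope_fun_def_field] at hslope
  rw [hasDerivAt_iff_tendsto_slope, slope_fun_def_field]
  refine (hD.mul hslope).congr' ?_
  have hmem : ∀ᶠ ee in 𝓝 e, ee ∈ Ioo (0 : ℝ) e' := Ioo_mem_nhds he.1 he.2
  filter_upwards [self_mem_nhdsWithin, eventually_nhdsWithin_of_eventually_nhds hmem] with ee hne hee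
  have hδne : 1 / ee ^ 2 - 1 / e ^ 2 ≠ 0 := invSq_sub_ne_zero he.1 hee.1 hne
  rw [div_mul_div_comm, mul_comm (1 / ee ^ 2 - 1 / e ^ 2), ← div_mul_div_comm, div_self hδne, mul_one]

/-! ## §119 Differentiability on the open box and the one-loop law at EVERY coupling -/

/-- **Λ IS DIFFERENTIABLE AT EVERY INTERIOR COUPLING** with **`deriv Λ e = −2W_∞∕e³ < 0`** and **`|(−e³∕2)·deriv Λ e − 1| ≤ C_m(8e³ + 16e∕β*)∕(1−θ)`** — the a.e. one-loop law of
part 57 (#73d) at EVERY coupling, under the C¹ shape; W_∞ is produced here from part 68's `tangent_exists` (no tangent-flow hypothesis remains).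
[cite: Balaban1987RG1, Thm 2 (0.31) p.259 with (0.20) p.256 and p.298] -/
theorem differentiableAt_dynAbel {B : (ℕ → ℝ) → ℝ} {G : (ℕ → ℝ) → ℕ → ℝ} {Cm θ γ bs ta gs e' : ℝ} {t : ℕ → ℝ} {a : ℕ → ℝ} {Λ : ℝ → ℝ}
    (hB : MemoryProfile Cm θ γ B) (hCm : 0 ≤ Cm) (hθ0 : 0 ≤ θ) (hθ1 : θ < 1) (hbs : 0 < bs) (hta : 0 < ta)
    (hts : SeqBox γ t) (htf : MemFlow B gs t) (hprof : ∀ m : ℕ, 1 / ta ^ 2 + bs * (m : ℝ) ≤ 1 / (t m) ^ 2)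
    (hG : ∀ u : ℕ → ℝ, SeqBox γ u → ∀ j, |G u j| ≤ Cm * θ ^ j)
    (hGB : ∀ ε > 0, ∃ ρ > 0, ∀ u u' : ℕ → ℝ, SeqBox γ u → SeqBox γ u' → (∀ j, |u' j - u j| ≤ ρ) →
      |B u' - B u - ∑' j, G u j * (u' j - u j)| ≤ ε * ∑' j, θ ^ j * |u' j - u j|)
    (hΛ : ∀ e ∈ Ioc (0 : ℝ) e', ∀ h : ℕ → ℝ, SeqBox γ h → MemFlow B e h → Tendsto (fun n => 1 / h n ^ 2 - a n) atTop (𝓝 (Λ e)))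
    (h2e' : 2 * e' ≤ γ) (hs1 : 4 * Cm * e' ≤ bs * (1 - θ))
    (hs2 : e' ^ 2 * (1 / gs ^ 2 + Cm * γ / (1 - θ) ^ 2 + (2 * Cm / ((1 - θ) * bs)) ^ 2) ≤ 3 / 4)
    (hs4 : 64 * Cm * e' ^ 3 ≤ (1 - θ) ^ 2) (hs5 : Cm * (8 * e' ^ 3 + 16 * e' / bs) ≤ (1 - θ) / 4) {e : ℝ} (he : e ∈ Ioo (0 : ℝ) e') :
    DifferentiableAt ℝ Λ e ∧ deriv Λ e < 0 ∧
      |(-(e ^ 3) / 2) * deriv Λ e - 1| ≤ Cm * (8 * e ^ 3 + 16 * e / bs) / (1 - θ) ∧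
      ∃ W : ℕ → ℝ, (∀ k, W k = 1 - ∑ p ∈ range k, ∑' j,
          G (fun i => solution B e (p + 1 + i)) j * ((solution B e (p + 1 + j)) ^ 3 / 2) * W (p + 1 + j)) ∧ (∀ k, |W k| ≤ 2) ∧
        ∃ Winf : ℝ, Tendsto W atTop (𝓝 Winf) ∧ HasDerivAt Λ (Winf * (-2 / e ^ 3)) e ∧ deriv Λ e = Winf * (-2 / e ^ 3) := by
  have hec : e ∈ Ioc (0 : ℝ) e' := ⟨he.1, he.2.le⟩
  obtain ⟨W, hW, hWM⟩ := tangent_exists hB hCm hθ0 hθ1 hbs hta hts htf hprof hG h2e' hs1 hs2 hs4 hs5 hec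
  obtain ⟨Winf, hT, -, h1, hlo, hhi⟩ := tangentLimit_exists hB hCm hθ0 hθ1 hbs hta hts htf hprof hG h2e' hs1 hs2 hs4 hs5 hec hW hWM
  have hd := hasDerivAt_dynAbel hB hCm hθ0 hθ1 hbs hta hts htf hprof hG hGB hΛ h2e' hs1 hs2 hs4 hs5 he hW hWM hT
  have hderiv : deriv Λ e = Winf * (-2 / e ^ 3) := hd.deriv
  have he3 : 0 < e ^ 3 := pow_pos he.1 3
  refine ⟨hd.differentiableAt, ?_, ?_, W, hW, hWM, Winf, hT, hd, hderiv⟩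
  · rw [hderiv, show Winf * (-2 / e ^ 3) = -(2 * Winf / e ^ 3) by ring, neg_lt_zero]
    positivity
  · have h3 : e ^ 3 ≠ 0 := pow_ne_zero 3 he.1.ne'
    rw [hderiv, show -(e ^ 3) / 2 * (Winf * (-2 / e ^ 3)) = Winf * (e ^ 3 / e ^ 3) by ring, div_self h3, mul_one]
    exact h1

/-- The derivative in closed form is unique: any tangent flow at e with any ultraviolet limit gives `deriv Λ e = −2W_∞∕e³`. [folklore] -/
theorem deriv_dynAbel_eq {B : (ℕ → ℝ) → ℝ} {G : (ℕ → ℝ) → ℕ → ℝ} {Cm θ γ bs ta gs e' : ℝ} {t W : ℕ → ℝ} {a : ℕ → ℝ} {Λ : ℝ → ℝ}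
    (hB : MemoryProfile Cm θ γ B) (hCm : 0 ≤ Cm) (hθ0 : 0 ≤ θ) (hθ1 : θ < 1) (hbs : 0 < bs) (hta : 0 < ta)
    (hts : SeqBox γ t) (htf : MemFlow B gs t) (hprof : ∀ m : ℕ, 1 / ta ^ 2 + bs * (m : ℝ) ≤ 1 / (t m) ^ 2)
    (hG : ∀ u : ℕ → ℝ, SeqBox γ u → ∀ j, |G u j| ≤ Cm * θ ^ j)
    (hGB : ∀ ε > 0, ∃ ρ > 0, ∀ u u' : ℕ → ℝ, SeqBox γ u → SeqBox γ u' → (∀ j, |u' j - u j| ≤ ρ) →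
      |B u' - B u - ∑' j, G u j * (u' j - u j)| ≤ ε * ∑' j, θ ^ j * |u' j - u j|)
    (hΛ : ∀ e ∈ Ioc (0 : ℝ) e', ∀ h : ℕ → ℝ, SeqBox γ h → MemFlow B e h → Tendsto (fun n => 1 / h n ^ 2 - a n) atTop (𝓝 (Λ e)))
    (h2e' : 2 * e' ≤ γ) (hs1 : 4 * Cm * e' ≤ bs * (1 - θ))
    (hs2 : e' ^ 2 * (1 / gs ^ 2 + Cm * γ / (1 - θ) ^ 2 + (2 * Cm / ((1 - θ) * bs)) ^ 2) ≤ 3 / 4)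
    (hs4 : 64 * Cm * e' ^ 3 ≤ (1 - θ) ^ 2) (hs5 : Cm * (8 * e' ^ 3 + 16 * e' / bs) ≤ (1 - θ) / 4) {e : ℝ} (he : e ∈ Ioo (0 : ℝ) e')
    (hW : ∀ k, W k = 1 - ∑ p ∈ range k, ∑' j, G (fun i => solution B e (p + 1 + i)) j * ((solution B e (p + 1 + j)) ^ 3 / 2) * W (p + 1 + j))
    (hWM : ∀ k, |W k| ≤ 2) {Winf : ℝ} (hWinf : Tendsto W atTop (𝓝 Winf)) :
    deriv Λ e = Winf * (-2 / e ^ 3) ∧ Winf = (-(e ^ 3) / 2) * deriv Λ e := by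
  have hd := (hasDerivAt_dynAbel hB hCm hθ0 hθ1 hbs hta hts htf hprof hG hGB hΛ h2e' hs1 hs2 hs4 hs5 he hW hWM hWinf).deriv
  refine ⟨hd, ?_⟩
  have h3 : e ^ 3 ≠ 0 := pow_ne_zero 3 he.1.ne'
  rw [hd, show -(e ^ 3) / 2 * (Winf * (-2 / e ^ 3)) = Winf * (e ^ 3 / e ^ 3) by ring, div_self h3, mul_one]

/-- **THE ONE-LOOP LAW OF THE DERIVATIVE AT EVERY INTERIOR COUPLING** (no «almost»): `|(−e³∕2)·Λ′(e) − 1| ≤ C_m(8e³ + 16e∕β*)∕(1−θ)` and `Λ′(e) < 0` on ]0, e′[.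
[cite: Balaban1987RG1, Thm 2 (0.31) p.259 with (0.20) p.256 and p.298] -/
theorem abs_deriv_dynAbel_oneLoop {B : (ℕ → ℝ) → ℝ} {G : (ℕ → ℝ) → ℕ → ℝ} {Cm θ γ bs ta gs e' : ℝ} {t : ℕ → ℝ} {a : ℕ → ℝ} {Λ : ℝ → ℝ}
    (hB : MemoryProfile Cm θ γ B) (hCm : 0 ≤ Cm) (hθ0 : 0 ≤ θ) (hθ1 : θ < 1) (hbs : 0 < bs) (hta : 0 < ta)
    (hts : SeqBox γ t) (htf : MemFlow B gs t) (hprof : ∀ m : ℕ, 1 / ta ^ 2 + bs * (m : ℝ) ≤ 1 / (t m) ^ 2)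
    (hG : ∀ u : ℕ → ℝ, SeqBox γ u → ∀ j, |G u j| ≤ Cm * θ ^ j)
    (hGB : ∀ ε > 0, ∃ ρ > 0, ∀ u u' : ℕ → ℝ, SeqBox γ u → SeqBox γ u' → (∀ j, |u' j - u j| ≤ ρ) →
      |B u' - B u - ∑' j, G u j * (u' j - u j)| ≤ ε * ∑' j, θ ^ j * |u' j - u j|)
    (hΛ : ∀ e ∈ Ioc (0 : ℝ) e', ∀ h : ℕ → ℝ, SeqBox γ h → MemFlow B e h → Tendsto (fun n => 1 / h n ^ 2 - a n) atTop (𝓝 (Λ e)))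
    (h2e' : 2 * e' ≤ γ) (hs1 : 4 * Cm * e' ≤ bs * (1 - θ))
    (hs2 : e' ^ 2 * (1 / gs ^ 2 + Cm * γ / (1 - θ) ^ 2 + (2 * Cm / ((1 - θ) * bs)) ^ 2) ≤ 3 / 4)
    (hs4 : 64 * Cm * e' ^ 3 ≤ (1 - θ) ^ 2) (hs5 : Cm * (8 * e' ^ 3 + 16 * e' / bs) ≤ (1 - θ) / 4) :
    ∀ e ∈ Ioo (0 : ℝ) e', |(-(e ^ 3) / 2) * deriv Λ e - 1| ≤ Cm * (8 * e ^ 3 + 16 * e / bs) / (1 - θ) ∧ deriv Λ e < 0 := by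
  intro e he
  obtain ⟨-, hneg, hone, -⟩ := differentiableAt_dynAbel hB hCm hθ0 hθ1 hbs hta hts htf hprof hG hGB hΛ h2e' hs1 hs2 hs4 hs5 he
  exact ⟨hone, hneg⟩

/-- The derivative lies between the two chart slopes `−8∕(3e³)`-type envelopes: `−(5∕2)∕e³ ≤ Λ′(e) ≤ −(3∕2)∕e³` (from `W_∞ ∈ [3∕4, 5∕4]`). [folklore] -/
theorem deriv_dynAbel_neg {B : (ℕ → ℝ) → ℝ} {G : (ℕ → ℝ) → ℕ → ℝ} {Cm θ γ bs ta gs e' : ℝ} {t : ℕ → ℝ} {a : ℕ → ℝ} {Λ : ℝ → ℝ}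
    (hB : MemoryProfile Cm θ γ B) (hCm : 0 ≤ Cm) (hθ0 : 0 ≤ θ) (hθ1 : θ < 1) (hbs : 0 < bs) (hta : 0 < ta)
    (hts : SeqBox γ t) (htf : MemFlow B gs t) (hprof : ∀ m : ℕ, 1 / ta ^ 2 + bs * (m : ℝ) ≤ 1 / (t m) ^ 2)
    (hG : ∀ u : ℕ → ℝ, SeqBox γ u → ∀ j, |G u j| ≤ Cm * θ ^ j)
    (hGB : ∀ ε > 0, ∃ ρ > 0, ∀ u u' : ℕ → ℝ, SeqBox γ u → SeqBox γ u' → (∀ j, |u' j - u j| ≤ ρ) →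
      |B u' - B u - ∑' j, G u j * (u' j - u j)| ≤ ε * ∑' j, θ ^ j * |u' j - u j|)
    (hΛ : ∀ e ∈ Ioc (0 : ℝ) e', ∀ h : ℕ → ℝ, SeqBox γ h → MemFlow B e h → Tendsto (fun n => 1 / h n ^ 2 - a n) atTop (𝓝 (Λ e)))
    (h2e' : 2 * e' ≤ γ) (hs1 : 4 * Cm * e' ≤ bs * (1 - θ))
    (hs2 : e' ^ 2 * (1 / gs ^ 2 + Cm * γ / (1 - θ) ^ 2 + (2 * Cm / ((1 - θ) * bs)) ^ 2) ≤ 3 / 4)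
    (hs4 : 64 * Cm * e' ^ 3 ≤ (1 - θ) ^ 2) (hs5 : Cm * (8 * e' ^ 3 + 16 * e' / bs) ≤ (1 - θ) / 4) {e : ℝ} (he : e ∈ Ioo (0 : ℝ) e') :
    -(5 / 2) / e ^ 3 ≤ deriv Λ e ∧ deriv Λ e ≤ -(3 / 2) / e ^ 3 := by
  have hec : e ∈ Ioc (0 : ℝ) e' := ⟨he.1, he.2.le⟩
  obtain ⟨W, hW, hWM⟩ := tangent_exists hB hCm hθ0 hθ1 hbs hta hts htf hprof hG h2e' hs1 hs2 hs4 hs5 hec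
  obtain ⟨Winf, hT, -, -, hlo, hhi⟩ := tangentLimit_exists hB hCm hθ0 hθ1 hbs hta hts htf hprof hG h2e' hs1 hs2 hs4 hs5 hec hW hWM
  have hd := (hasDerivAt_dynAbel hB hCm hθ0 hθ1 hbs hta hts htf hprof hG hGB hΛ h2e' hs1 hs2 hs4 hs5 he hW hWM hT).deriv
  have he3 : 0 < e ^ 3 := pow_pos he.1 3
  rw [hd, show Winf * (-2 / e ^ 3) = -(2 * Winf) / e ^ 3 by ring]
  constructor
  · rw [div_le_div_iff₀ he3 he3]; nlinarith
  · rw [div_le_div_iff₀ he3 he3]; nlinarith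

/-- **Λ IS DIFFERENTIABLE ON THE OPEN BOX ]0, e′[** — every dynamical Abel function of a flow whose functional is differentiable along the history.
[cite: Balaban1987RG1, Thm 2 (0.31) p.259 with (0.20) p.256 and p.298] -/
theorem differentiableOn_dynAbel {B : (ℕ → ℝ) → ℝ} {G : (ℕ → ℝ) → ℕ → ℝ} {Cm θ γ bs ta gs e' : ℝ} {t : ℕ → ℝ} {a : ℕ → ℝ} {Λ : ℝ → ℝ}
    (hB : MemoryProfile Cm θ γ B) (hCm : 0 ≤ Cm) (hθ0 : 0 ≤ θ) (hθ1 : θ < 1) (hbs : 0 < bs) (hta : 0 < ta)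
    (hts : SeqBox γ t) (htf : MemFlow B gs t) (hprof : ∀ m : ℕ, 1 / ta ^ 2 + bs * (m : ℝ) ≤ 1 / (t m) ^ 2)
    (hG : ∀ u : ℕ → ℝ, SeqBox γ u → ∀ j, |G u j| ≤ Cm * θ ^ j)
    (hGB : ∀ ε > 0, ∃ ρ > 0, ∀ u u' : ℕ → ℝ, SeqBox γ u → SeqBox γ u' → (∀ j, |u' j - u j| ≤ ρ) →
      |B u' - B u - ∑' j, G u j * (u' j - u j)| ≤ ε * ∑' j, θ ^ j * |u' j - u j|)
    (hΛ : ∀ e ∈ Ioc (0 : ℝ) e', ∀ h : ℕ → ℝ, SeqBox γ h → MemFlow B e h → Tendsto (fun n => 1 / h n ^ 2 - a n) atTop (𝓝 (Λ e)))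
    (h2e' : 2 * e' ≤ γ) (hs1 : 4 * Cm * e' ≤ bs * (1 - θ))
    (hs2 : e' ^ 2 * (1 / gs ^ 2 + Cm * γ / (1 - θ) ^ 2 + (2 * Cm / ((1 - θ) * bs)) ^ 2) ≤ 3 / 4)
    (hs4 : 64 * Cm * e' ^ 3 ≤ (1 - θ) ^ 2) (hs5 : Cm * (8 * e' ^ 3 + 16 * e' / bs) ≤ (1 - θ) / 4) :
    DifferentiableOn ℝ Λ (Ioo 0 e') ∧ ∀ x ∈ Ioo (0 : ℝ) e', HasDerivAt Λ (deriv Λ x) x :=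
  ⟨fun _ hx => (differentiableAt_dynAbel hB hCm hθ0 hθ1 hbs hta hts htf hprof hG hGB hΛ h2e' hs1 hs2 hs4 hs5 hx).1.differentiableWithinAt,
    fun _ hx => (differentiableAt_dynAbel hB hCm hθ0 hθ1 hbs hta hts htf hprof hG hGB hΛ h2e' hs1 hs2 hs4 hs5 hx).1.hasDerivAt⟩

end

end Summit.QuantumFields.BalabanUV.Beta.EriceFlowEnclosureB12AsPrintedHistoryContagionShiftFlowZeroTangentLambda
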